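import Literature.Analysis.FluidPDE.PassiveScalarDiagMildBounds
import Literature.Analysis.FluidPDE.PassiveScalarDiagMildWeakMode
import HarnessLib

/-!
# Mild (Duhamel) formulation of the passive scalar equation with constant diagonal diffusion and
  bounded drift, VIII: a mild solution satisfies the weak formulation

Analysis/FluidPDE proof-support file (everything proved). For an `L^∞_t L²_x` field `θ` on `[0,T]`
with time-continuous Fourier coefficients satisfying the undamped mild equation
`𝓕(θ(t))(k) = e^{-νₖt}θ̂₀(k) - ∫_{(0,t]} e^{-νₖ(t-s)} N(θ)(s)(k) ds`, a bounded drift, `κ ≥ 0`,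
`aᵢ > 0`, `θ₀ ∈ L²`, and every space–time test function `ψ`:
`∫₀ᵀ∫ θ(∂ₜψ + u·∇ψ + κ∑ᵢaᵢ∂ᵢ∂ᵢψ) + ∫θ₀ψ(0) = 0` (`weak_eq_of_mild`). Steps: the slice Parseval
identity `∫θ(t)(…)(t) = ∑ₖ f_k(t)` at a.e. `t` (`ae_hasSum_modeIntegrand`), the uniform decay
`‖f_k(t)‖ ≤ M(1+‖k‖)^{-2#d}` giving integrability and `∑ₖ∫‖f_k‖ < ∞`, the exchange of the mode sum
with the time integral, the per-mode identity of `PassiveScalarDiagMildWeakMode`, and Parseval for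
the datum term.

## References

* A. Pazy, *Semigroups of Linear Operators and Applications to PDE*, Springer 1983, Ch. 4 §4.2
  (mild solutions, (2.3), Def. 2.3), Ch. 6 §6.1 Thm. 1.2 (Picard iteration for the mild equation).
* R. J. DiPerna, P.-L. Lions, Invent. Math. 98 (1989) 511–547, §II.1. L. C. Evans, *PDE* (2010), §7.1.2.
* L. Grafakos, *Classical Fourier Analysis*, 3rd ed. (2014), Prop. 3.2.6 (4), (8), Prop. 3.2.7 (3), §3.3.1.
* J. C. Robinson, J. L. Rodrigo, W. Sadowski, *The Three-Dimensional Navier–Stokes Equations* (2016), Thm. 4.11.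
-/

noncomputable section

open MeasureTheory TopologicalSpace Set Function Filter UnitAddTorus
open _root_.Topology
open scoped ENNReal NNReal InnerProductSpace ComplexConjugate

namespace Literature.Analysis.FluidPDE

namespace Torus

open Literature.Analysis.FunctionSpaces.Torus Literature.Analysis.FunctionSpaces

variable {d : Type*} [Fintype d]

/-! ## Mild ⇒ weak, III: the weak formulation of an (undamped) mild solution -/

section WeakForm

variable [DecidableEq d]
variable {T U E κ : ℝ} {a : d → ℝ} {u : ℝ → UnitAddTorus d → EuclideanSpace ℝ d}
  {θ : ℝ → UnitAddTorus d → ℝ} {θ₀ : UnitAddTorus d → ℝ} {ψ : ℝ → UnitAddTorus d → ℝ}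

/-- The **mode integrand** of the weak formulation: the `k`-th term of the Parseval expansion of
`∫ θ(t) (∂ₜψ + u·∇ψ + κ∑ᵢaᵢ∂ᵢ∂ᵢψ)(t)`, namely
`conj(𝓕(∂ₜψ(t))(k)) θ̂(t)(k) - conj(ψ̂(t)(k)) N(θ)(t)(k) - νₖ conj(ψ̂(t)(k)) θ̂(t)(k)`. [cite: Grafakos2014, Prop. 3.2.7 (3)] -/
def modeIntegrand (κ : ℝ) (a : d → ℝ) (u : ℝ → UnitAddTorus d → EuclideanSpace ℝ d)
    (θ : ℝ → UnitAddTorus d → ℝ) (ψ : ℝ → UnitAddTorus d → ℝ) (t : ℝ) (k : d → ℤ) : ℂ :=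
  conj (testCoeff (FunctionSpaces.Torus.timeDeriv ψ) t k) * mFourierCoeff (fun x => (θ t x : ℂ)) k -
    conj (testCoeff ψ t k) * transportCoeff u θ t k -
    (diagRate κ a k : ℂ) * (conj (testCoeff ψ t k) * mFourierCoeff (fun x => (θ t x : ℂ)) k)

omit [DecidableEq d] in
/-- `‖θ̂(t)(k)‖ ≤ √E` for a field with `∫ θ(t)² ≤ E` (single-mode Bessel). [cite: Grafakos2014, Prop. 3.2.7 (3)] -/
theorem norm_mFourierCoeff_le_sqrt (hθ : IsL2Field T E θ) {t : ℝ} (ht : t ∈ Icc 0 T) (k : d → ℤ) :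
    ‖mFourierCoeff (fun x => (θ t x : ℂ)) k‖ ≤ Real.sqrt E := by
  refine Real.le_sqrt_of_sq_le ?_
  exact (sq_norm_mFourierCoeff_le_integral_sq (hθ.memLp t ht) k).trans (hθ.integral_sq_le t ht)

omit [DecidableEq d] in
/-- `Qₐ(k) ≤ (∑ᵢ aᵢ)(1 + ‖k‖)²` for nonnegative coefficients. [cite: Grafakos2014, Prop. 3.2.6 (8)] -/
theorem diagFreqSq_le (ha : ∀ i, 0 ≤ a i) (k : d → ℤ) : diagFreqSq a k ≤ (∑ i, a i) * (1 + ‖k‖) ^ 2 := by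
  rw [diagFreqSq_apply, Finset.sum_mul]
  refine Finset.sum_le_sum fun i _ => mul_le_mul_of_nonneg_left ?_ (ha i)
  have h1 : |(k i : ℝ)| ≤ ‖k‖ := by
    rw [← Real.norm_eq_abs, Int.norm_cast_real]
    exact norm_le_pi_norm k i
  calc (k i : ℝ) ^ 2 = |(k i : ℝ)| ^ 2 := (sq_abs _).symm
    _ ≤ ‖k‖ ^ 2 := pow_le_pow_left₀ (abs_nonneg _) h1 2
    _ ≤ (1 + ‖k‖) ^ 2 := pow_le_pow_left₀ (norm_nonneg _) (by linarith [norm_nonneg k]) 2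


omit [DecidableEq d] in
/-- Continuous real functions on the torus are in `L²`. [folklore] -/
private theorem memLp_two_of_continuous' {f : UnitAddTorus d → ℝ} (hf : Continuous f) : MemLp f 2 volume :=
  hf.memLp_of_hasCompactSupport (HasCompactSupport.of_compactSpace f)

/-- **The slice Parseval identity.** At a.e. time `t ∈ (0,T)` (where the drift slice is bounded
and measurable), the pairing of `θ(t)` with the test integrand expands over the Fourier modes:
`∫ θ(t)(∂ₜψ + u·∇ψ + κ∑ᵢaᵢ∂ᵢ∂ᵢψ)(t) = ∑ₖ f_k(t)` with `f_k` the mode integrand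
(Parseval for the pairs `(θ, ∂ₜψ)`, `(uⱼθ, ∂ⱼψ)`, `(θ, ∑aᵢ∂ᵢ∂ᵢψ)`; Grafakos 2014, Prop. 3.2.7 (3),
Prop. 3.2.6 (8)). [cite: Grafakos2014, Prop. 3.2.7 (3)] -/
theorem ae_hasSum_modeIntegrand (hu : DriftBound T u U) (hθ : IsL2Field T E θ) (hψ : IsSpaceTimeTest T ψ) :
    ∀ᵐ t ∂((volume : Measure ℝ).restrict (Ioo 0 T)),
      HasSum (fun k => modeIntegrand κ a u θ ψ t k)
        (((∫ x, θ t x * (FunctionSpaces.Torus.timeDeriv ψ t x +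
            ⟪u t x, FunctionSpaces.Torus.gradient (ψ t) x⟫_ℝ +
            κ * ∑ i, a i * FunctionSpaces.Torus.partialDeriv i
              (FunctionSpaces.Torus.partialDeriv i (ψ t)) x) : ℝ) : ℂ)) := by
  have hj : ∀ᵐ t ∂((volume : Measure ℝ).restrict (Ioo 0 T)), ∀ j,
      MemLp (fun x => u t x j * θ t x) 2 volume ∧ ∫ x, (u t x j * θ t x) ^ 2 ≤ U ^ 2 * E := by
    rw [eventually_all]; exact fun j => ae_memLp_apply_mul hu hθ j
  filter_upwards [hj, ae_restrict_mem measurableSet_Ioo] with t hjt htI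
  have ht : t ∈ Icc 0 T := Ioo_subset_Icc_self htI
  have hθt : MemLp (θ t) 2 volume := hθ.memLp t ht
  have hψt : IsSmooth (ψ t) := hψ.isSmooth_slice t
  have hdψ : IsSmooth (FunctionSpaces.Torus.timeDeriv ψ t) := hψ.timeDeriv.isSmooth_slice t
  set dψ : UnitAddTorus d → ℝ := FunctionSpaces.Torus.timeDeriv ψ t with hdψdef
  set Aψ : UnitAddTorus d → ℝ := fun x => ∑ i, a i * FunctionSpaces.Torus.partialDeriv i
    (FunctionSpaces.Torus.partialDeriv i (ψ t)) x with hAψ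
  set Dψ : d → UnitAddTorus d → ℝ := fun j x => FunctionSpaces.Torus.partialDeriv j (ψ t) x with hDψ
  have hAc : Continuous Aψ := continuous_finsetSum _ fun i _ =>
    continuous_const.mul ((hψt.partialDeriv i).partialDeriv i).continuous
  have hAm : MemLp Aψ 2 volume := memLp_two_of_continuous' hAc
  have hDm : ∀ j, MemLp (Dψ j) 2 volume := fun j => (hψt.partialDeriv j).memLp 2
  have hdm : MemLp dψ 2 volume := hdψ.memLp 2
  -- (i) the pointwise splitting of the integrand
  have hsplit : ∀ x, θ t x * (dψ x + ⟪u t x, FunctionSpaces.Torus.gradient (ψ t) x⟫_ℝ + κ * Aψ x) =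
      θ t x * dψ x + ∑ j, (u t x j * θ t x) * Dψ j x + κ * (θ t x * Aψ x) := by
    intro x
    rw [FunctionSpaces.Torus.inner_gradient_eq_sum_mul_partialDeriv (hψt.isContDiff (by simp)), mul_add, mul_add,
      Finset.mul_sum]
    congr 1
    · congr 1
      exact Finset.sum_congr rfl fun j _ => by simp only [hDψ]; ring
    · ring
  -- (ii) integrability of the three pieces and the split of the integral
  have hI1 : Integrable (fun x => θ t x * dψ x) volume := hθt.integrable_mul hdm
  have hI2 : ∀ j, Integrable (fun x => (u t x j * θ t x) * Dψ j x) volume := fun j =>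
    (hjt j).1.integrable_mul (hDm j)
  have hI3 : Integrable (fun x => θ t x * Aψ x) volume := hθt.integrable_mul hAm
  have hI2s : Integrable (fun x => ∑ j, (u t x j * θ t x) * Dψ j x) volume :=
    integrable_finsetSum _ fun j _ => hI2 j
  have hI12 : Integrable (fun x => θ t x * dψ x + ∑ j, (u t x j * θ t x) * Dψ j x) volume := hI1.add hI2s
  have hI3κ : Integrable (fun x => κ * (θ t x * Aψ x)) volume := hI3.const_mul κ
  have hint : (∫ x, θ t x * (dψ x + ⟪u t x, FunctionSpaces.Torus.gradient (ψ t) x⟫_ℝ + κ * Aψ x)) =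
      (∫ x, θ t x * dψ x) + ∑ j, (∫ x, (u t x j * θ t x) * Dψ j x) + κ * ∫ x, θ t x * Aψ x := by
    rw [integral_congr_ae (ae_of_all _ hsplit), integral_add hI12 hI3κ, integral_add hI1 hI2s,
      integral_finsetSum _ fun j _ => hI2 j, integral_const_mul]
  -- (iii) the three Parseval identities
  have H1 := hasSum_conj_mul_mFourierCoeff_ofReal hθt hdm
  have H2 : ∀ j, HasSum (fun k : d → ℤ => conj ((2 * Real.pi * Complex.I * (k j : ℂ)) * testCoeff ψ t k) *
      mFourierCoeff (fun x => ((u t x j * θ t x : ℝ) : ℂ)) k) (((∫ x, (u t x j * θ t x) * Dψ j x : ℝ) : ℂ)) := by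
    intro j
    have h := hasSum_conj_mul_mFourierCoeff_ofReal (hjt j).1 (hDm j)
    simp only [hDψ, mFourierCoeff_ofReal_partialDeriv hψt j] at h
    exact h
  have H3 := hasSum_conj_mul_mFourierCoeff_ofReal hθt hAm
  have hA : ∀ k, mFourierCoeff (fun x => (Aψ x : ℂ)) k =
      -((4 * Real.pi ^ 2 * diagFreqSq a k : ℝ) : ℂ) * testCoeff ψ t k := fun k =>
    mFourierCoeff_ofReal_diagOp hψt a k
  simp only [hA] at H3
  have H2s := hasSum_sum (s := (Finset.univ : Finset d)) fun j _ => H2 j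
  have H := (H1.add H2s).add (H3.mul_left (κ : ℂ))
  -- identify the terms
  have e : (fun k => modeIntegrand κ a u θ ψ t k) = fun k =>
      conj (mFourierCoeff (fun x => ((dψ x : ℝ) : ℂ)) k) * mFourierCoeff (fun x => ((θ t x : ℝ) : ℂ)) k +
      ∑ j, conj ((2 * Real.pi * Complex.I * (k j : ℂ)) * testCoeff ψ t k) *
        mFourierCoeff (fun x => ((u t x j * θ t x : ℝ) : ℂ)) k +
      (κ : ℂ) * (conj (-((4 * Real.pi ^ 2 * diagFreqSq a k : ℝ) : ℂ) * testCoeff ψ t k) *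
        mFourierCoeff (fun x => ((θ t x : ℝ) : ℂ)) k) := by
    funext k
    have hsum : ∑ j, conj ((2 * Real.pi * Complex.I * (k j : ℂ)) * testCoeff ψ t k) *
        mFourierCoeff (fun x => ((u t x j * θ t x : ℝ) : ℂ)) k =
        -(conj (testCoeff ψ t k) * transportCoeff u θ t k) := by
      rw [transportCoeff_apply, Finset.mul_sum, ← Finset.sum_neg_distrib]
      refine Finset.sum_congr rfl fun j _ => ?_
      simp only [map_mul, Complex.conj_I, Complex.conj_ofReal, map_ofNat, map_intCast]
      ring
    have hA' : (κ : ℂ) * (conj (-((4 * Real.pi ^ 2 * diagFreqSq a k : ℝ) : ℂ) * testCoeff ψ t k) *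
        mFourierCoeff (fun x => ((θ t x : ℝ) : ℂ)) k) =
        -((diagRate κ a k : ℂ) * (conj (testCoeff ψ t k) * mFourierCoeff (fun x => ((θ t x : ℝ) : ℂ)) k)) := by
      rw [map_mul, map_neg, Complex.conj_ofReal, diagRate_apply]
      push_cast
      ring
    rw [hsum, hA', modeIntegrand]
    show _ = conj (testCoeff (FunctionSpaces.Torus.timeDeriv ψ) t k) * mFourierCoeff (fun x => ((θ t x : ℝ) : ℂ)) k +
      -(conj (testCoeff ψ t k) * transportCoeff u θ t k) +
      -((diagRate κ a k : ℂ) * (conj (testCoeff ψ t k) * mFourierCoeff (fun x => ((θ t x : ℝ) : ℂ)) k))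
    ring
  rw [e]
  convert H using 1
  rw [hint]
  push_cast
  ring


/-- **Uniform polynomial decay of the mode integrand**: there is `M` with
`‖f_k(t)‖ ≤ M (1 + ‖k‖)^{-2#d}` for a.e. `t ∈ (0,T)` and all `k` (decay of every order of the
test coefficients against the polynomial growth `‖θ̂‖ ≤ √E`, `‖N(θ)(k)‖ ≲ (1+‖k‖)`, `νₖ ≲ (1+‖k‖)²`).
[cite: Grafakos2014, §3.3.1] -/
theorem exists_ae_norm_modeIntegrand_le (hT : 0 < T) (hκ : 0 ≤ κ) (ha : ∀ i, 0 < a i)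
    (hu : DriftBound T u U) (hθ : IsL2Field T E θ) (hψ : IsSpaceTimeTest T ψ) :
    ∃ M : ℝ, 0 ≤ M ∧ ∀ᵐ t ∂((volume : Measure ℝ).restrict (Ioo 0 T)), ∀ k,
      ‖modeIntegrand κ a u θ ψ t k‖ ≤ M * ((1 + ‖k‖) ^ ScalarFourier.latOrder d)⁻¹ := by
  set L := ScalarFourier.latOrder d with hL
  obtain ⟨C₀, hC₀, hφ⟩ := exists_hasDecay_testCoeff hT hψ (L + 2)
  obtain ⟨C₁, hC₁, hφ'⟩ := exists_hasDecay_testCoeff hT hψ.timeDeriv (L + 2)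
  have hE : 0 ≤ E := hθ.nonneg hT.le
  set Sa : ℝ := ∑ i, a i with hSa
  set Cg : ℝ := (∑ j, (a j)⁻¹) * (U ^ 2 * E) with hCg
  have hSa0 : 0 ≤ Sa := Finset.sum_nonneg fun i _ => (ha i).le
  have hCg0 : 0 ≤ Cg := by
    have : 0 ≤ ∑ j, (a j)⁻¹ := Finset.sum_nonneg fun j _ => inv_nonneg.2 (ha j).le
    positivity
  set M : ℝ := C₁ * Real.sqrt E + C₀ * (2 * Real.pi * Real.sqrt Sa * Real.sqrt Cg) +
    4 * Real.pi ^ 2 * κ * Sa * (C₀ * Real.sqrt E) with hM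
  refine ⟨M, by positivity, ?_⟩
  filter_upwards [ae_transportWeight_le hu hθ ha, ae_restrict_mem measurableSet_Ioo] with t hgw htI k
  have ht : t ∈ Icc 0 T := Ioo_subset_Icc_self htI
  set w : ℝ := ((1 + ‖k‖) ^ (L + 2))⁻¹ with hw
  have hk1 : 1 ≤ 1 + ‖k‖ := by linarith [norm_nonneg k]
  have hw0 : 0 ≤ w := by positivity
  -- the four elementary bounds
  have hc : ‖mFourierCoeff (fun x => (θ t x : ℂ)) k‖ ≤ Real.sqrt E := norm_mFourierCoeff_le_sqrt hθ ht k
  have hφk : ‖testCoeff ψ t k‖ ≤ C₀ * w := hφ t ht k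
  have hφ'k : ‖testCoeff (FunctionSpaces.Torus.timeDeriv ψ) t k‖ ≤ C₁ * w := hφ' t ht k
  have hQ : Real.sqrt (diagFreqSq a k) ≤ Real.sqrt Sa * (1 + ‖k‖) := by
    rw [← Real.sqrt_sq (by positivity : 0 ≤ 1 + ‖k‖), ← Real.sqrt_mul hSa0]
    exact Real.sqrt_le_sqrt (diagFreqSq_le (fun i => (ha i).le) k)
  have hN : ‖transportCoeff u θ t k‖ ≤ 2 * Real.pi * Real.sqrt Sa * Real.sqrt Cg * (1 + ‖k‖) := by
    refine (norm_transportCoeff_le ha u θ t k).trans ?_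
    calc 2 * Real.pi * Real.sqrt (diagFreqSq a k) * Real.sqrt (transportWeight a u θ t k)
        ≤ 2 * Real.pi * (Real.sqrt Sa * (1 + ‖k‖)) * Real.sqrt Cg := by
          gcongr
          exact hgw k
      _ = 2 * Real.pi * Real.sqrt Sa * Real.sqrt Cg * (1 + ‖k‖) := by ring
  have hν : (0 : ℝ) ≤ diagRate κ a k := diagRate_nonneg hκ (fun i => (ha i).le) k
  have hν' : diagRate κ a k ≤ 4 * Real.pi ^ 2 * κ * Sa * (1 + ‖k‖) ^ 2 := by
    rw [diagRate_apply, mul_assoc (4 * Real.pi ^ 2 * κ)]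
    exact mul_le_mul_of_nonneg_left (diagFreqSq_le (fun i => (ha i).le) k) (by positivity)
  -- the three terms
  have h1 : ‖conj (testCoeff (FunctionSpaces.Torus.timeDeriv ψ) t k) * mFourierCoeff (fun x => (θ t x : ℂ)) k‖ ≤
      C₁ * w * Real.sqrt E := by
    rw [norm_mul, Complex.norm_conj]
    exact mul_le_mul hφ'k hc (norm_nonneg _) (by positivity)
  have h2 : ‖conj (testCoeff ψ t k) * transportCoeff u θ t k‖ ≤
      C₀ * w * (2 * Real.pi * Real.sqrt Sa * Real.sqrt Cg * (1 + ‖k‖)) := by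
    rw [norm_mul, Complex.norm_conj]
    exact mul_le_mul hφk hN (norm_nonneg _) (by positivity)
  have h3 : ‖(diagRate κ a k : ℂ) * (conj (testCoeff ψ t k) * mFourierCoeff (fun x => (θ t x : ℂ)) k)‖ ≤
      4 * Real.pi ^ 2 * κ * Sa * (1 + ‖k‖) ^ 2 * (C₀ * w * Real.sqrt E) := by
    rw [norm_mul, norm_mul, Complex.norm_real, Real.norm_of_nonneg hν, Complex.norm_conj]
    exact mul_le_mul hν' (mul_le_mul hφk hc (norm_nonneg _) (by positivity)) (by positivity) (by positivity)
  -- the weight algebra `(1+‖k‖)² w = ((1+‖k‖)^L)⁻¹`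
  have hwL : (1 + ‖k‖) ^ 2 * w = ((1 + ‖k‖) ^ L)⁻¹ := by
    rw [hw, pow_add]
    field_simp
  have hw1 : w ≤ (1 + ‖k‖) ^ 2 * w := le_mul_of_one_le_left hw0 (one_le_pow₀ hk1)
  have hw2 : w * (1 + ‖k‖) ≤ (1 + ‖k‖) ^ 2 * w := by
    have h : w * (1 + ‖k‖) ≤ (1 + ‖k‖) * (w * (1 + ‖k‖)) := le_mul_of_one_le_left (by positivity) hk1
    exact h.trans_eq (by ring)
  calc ‖modeIntegrand κ a u θ ψ t k‖
      ≤ ‖conj (testCoeff (FunctionSpaces.Torus.timeDeriv ψ) t k) * mFourierCoeff (fun x => (θ t x : ℂ)) k‖ +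
        ‖conj (testCoeff ψ t k) * transportCoeff u θ t k‖ +
        ‖(diagRate κ a k : ℂ) * (conj (testCoeff ψ t k) * mFourierCoeff (fun x => (θ t x : ℂ)) k)‖ := by
          rw [modeIntegrand]; exact norm_sub_le_of_le (norm_sub_le _ _) le_rfl
    _ ≤ C₁ * w * Real.sqrt E + C₀ * w * (2 * Real.pi * Real.sqrt Sa * Real.sqrt Cg * (1 + ‖k‖)) +
        4 * Real.pi ^ 2 * κ * Sa * (1 + ‖k‖) ^ 2 * (C₀ * w * Real.sqrt E) := add_le_add (add_le_add h1 h2) h3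
    _ = (C₁ * Real.sqrt E) * w + (C₀ * (2 * Real.pi * Real.sqrt Sa * Real.sqrt Cg)) * (w * (1 + ‖k‖)) +
        (4 * Real.pi ^ 2 * κ * Sa * (C₀ * Real.sqrt E)) * ((1 + ‖k‖) ^ 2 * w) := by ring
    _ ≤ (C₁ * Real.sqrt E) * ((1 + ‖k‖) ^ 2 * w) + (C₀ * (2 * Real.pi * Real.sqrt Sa * Real.sqrt Cg)) *
          ((1 + ‖k‖) ^ 2 * w) + (4 * Real.pi ^ 2 * κ * Sa * (C₀ * Real.sqrt E)) * ((1 + ‖k‖) ^ 2 * w) := by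
          gcongr
    _ = M * ((1 + ‖k‖) ^ L)⁻¹ := by rw [← hwL, hM]; ring

omit [DecidableEq d] in
/-- The mode integrand is a.e. strongly measurable in time on `(0,T)` (continuous test
coefficients, continuous field coefficients, measurable transport coefficient). [cite: Grafakos2014, Prop. 3.2.7 (3)] -/
theorem aestronglyMeasurable_modeIntegrand (hu : DriftBound T u U) (hθ : IsL2Field T E θ)
    (hcont : ∀ k, ContinuousOn (fun t => mFourierCoeff (fun x => (θ t x : ℂ)) k) (Icc 0 T))
    (hψ : IsSpaceTimeTest T ψ) (k : d → ℤ) :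
    AEStronglyMeasurable (fun t => modeIntegrand κ a u θ ψ t k) ((volume : Measure ℝ).restrict (Ioo 0 T)) := by
  have hc : AEStronglyMeasurable (fun t => mFourierCoeff (fun x => (θ t x : ℂ)) k)
      ((volume : Measure ℝ).restrict (Ioo 0 T)) :=
    ((hcont k).mono Ioo_subset_Icc_self).aestronglyMeasurable measurableSet_Ioo
  have hφ : AEStronglyMeasurable (fun t => conj (testCoeff ψ t k)) ((volume : Measure ℝ).restrict (Ioo 0 T)) :=
    (Complex.continuous_conj.comp (continuous_testCoeff hψ k)).aestronglyMeasurable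
  have hφ' : AEStronglyMeasurable (fun t => conj (testCoeff (FunctionSpaces.Torus.timeDeriv ψ) t k))
      ((volume : Measure ℝ).restrict (Ioo 0 T)) :=
    (Complex.continuous_conj.comp (continuous_testCoeff hψ.timeDeriv k)).aestronglyMeasurable
  have hN := (integrable_transportCoeff hu hθ k).aestronglyMeasurable
  unfold modeIntegrand
  exact ((hφ'.mul hc).sub (hφ.mul hN)).sub (aestronglyMeasurable_const.mul (hφ.mul hc))

/-- **Integrability of the mode integrand in time and summability of its `L¹` norms over the
modes** (from the uniform decay `‖f_k(t)‖ ≤ M(1+‖k‖)^{-2#d}` and `∑ₖ (1+‖k‖)^{-2#d} < ∞`). [cite: Grafakos2014, §3.3.1] -/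
theorem integrable_modeIntegrand_and_summable (hT : 0 < T) (hκ : 0 ≤ κ) (ha : ∀ i, 0 < a i)
    (hu : DriftBound T u U) (hθ : IsL2Field T E θ)
    (hcont : ∀ k, ContinuousOn (fun t => mFourierCoeff (fun x => (θ t x : ℂ)) k) (Icc 0 T))
    (hψ : IsSpaceTimeTest T ψ) :
    (∀ k, Integrable (fun t => modeIntegrand κ a u θ ψ t k) ((volume : Measure ℝ).restrict (Ioo 0 T))) ∧
      Summable fun k => ∫ t in Ioo 0 T, ‖modeIntegrand κ a u θ ψ t k‖ := by
  haveI : IsFiniteMeasure ((volume : Measure ℝ).restrict (Ioo 0 T)) :=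
    isFiniteMeasure_restrict.2 measure_Ioo_lt_top.ne
  obtain ⟨M, hM0, hM⟩ := exists_ae_norm_modeIntegrand_le hT hκ ha hu hθ hψ
  have hint : ∀ k, Integrable (fun t => modeIntegrand κ a u θ ψ t k) ((volume : Measure ℝ).restrict (Ioo 0 T)) :=
    fun k => Integrable.of_bound (aestronglyMeasurable_modeIntegrand hu hθ hcont hψ k) _
      (hM.mono fun t ht => ht k)
  refine ⟨hint, ?_⟩
  refine Summable.of_nonneg_of_le (fun k => integral_nonneg fun t => norm_nonneg _) (fun k => ?_)
    ((ScalarFourier.summable_latWeight (d := d)).mul_left (T * M))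
  have h1 : ∫ t in Ioo 0 T, ‖modeIntegrand κ a u θ ψ t k‖ ≤
      ∫ _ in Ioo 0 T, M * ((1 + ‖k‖) ^ ScalarFourier.latOrder d)⁻¹ :=
    integral_mono_ae (hint k).norm (integrable_const _) (hM.mono fun t ht => ht k)
  refine h1.trans (le_of_eq ?_)
  rw [setIntegral_const, Real.volume_real_Ioo_of_le hT.le, smul_eq_mul, sub_zero]
  ring


/-- Conjugation commutes with time derivatives of complex coefficient functions. [cite: Grafakos2014, Prop. 3.2.6 (4)] -/
theorem hasDerivAt_conj_comp {f : ℝ → ℂ} {f' : ℂ} {t : ℝ} (h : HasDerivAt f f' t) :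
    HasDerivAt (fun s => conj (f s)) (conj f') t := by
  have h2 := h.star
  simp only [RCLike.star_def] at h2
  exact h2

/-- **A mild solution is a weak solution (the weak formulation).** Let `θ` be an `L^∞_t L²_x` field
on `[0,T]` with time-continuous Fourier coefficients satisfying the (undamped) mild equation
`𝓕(θ(t))(k) = e^{-νₖt} θ̂₀(k) - ∫_{(0,t]} e^{-νₖ(t-s)} N(θ)(s)(k) ds` on `[0,T]`, for a bounded drift,
`κ ≥ 0`, `aᵢ > 0`, `θ₀ ∈ L²`. Then for every space–time test function `ψ` on `T^d × [0,T)`,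
`∫₀ᵀ ∫ θ (∂ₜψ + u·∇ψ + κ ∑ᵢ aᵢ ∂ᵢ∂ᵢψ) + ∫ θ₀ ψ(0) = 0` (Parseval slice by slice, exchange of the
mode sum with the time integral, and the per-mode identity `mild_mode_weak_identity`; Pazy 1983,
Ch. 4 §4.2: mild solutions are weak solutions). [cite: Pazy1983, Ch. 4 §4.2, Def. 2.3–Thm. 2.4, pp. 106–107] -/
theorem weak_eq_of_mild (hT : 0 < T) (hκ : 0 ≤ κ) (ha : ∀ i, 0 < a i) (hu : DriftBound T u U)
    (hθ : IsL2Field T E θ) (hθ₀ : MemLp θ₀ 2 volume)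
    (hcont : ∀ k, ContinuousOn (fun t => mFourierCoeff (fun x => (θ t x : ℂ)) k) (Icc 0 T))
    (hmild : ∀ t ∈ Icc 0 T, ∀ k, mFourierCoeff (fun x => (θ t x : ℂ)) k = mildMap κ a 0 u θ₀ θ t k)
    (hψ : IsSpaceTimeTest T ψ) :
    (∫ t in Ioo 0 T, ∫ x, θ t x *
        (FunctionSpaces.Torus.timeDeriv ψ t x + ⟪u t x, FunctionSpaces.Torus.gradient (ψ t) x⟫_ℝ +
          κ * ∑ i, a i * FunctionSpaces.Torus.partialDeriv i (FunctionSpaces.Torus.partialDeriv i (ψ t)) x)) +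
      ∫ x, θ₀ x * ψ 0 x = 0 := by
  obtain ⟨hint, hsum⟩ := integrable_modeIntegrand_and_summable hT hκ ha hu hθ hcont hψ
  obtain ⟨T', hT'T, hψ0⟩ := exists_testCoeff_eq_zero hψ
  -- (1) the space–time pairing as a sum over the modes
  have h1 : (((∫ t in Ioo 0 T, ∫ x, θ t x *
        (FunctionSpaces.Torus.timeDeriv ψ t x + ⟪u t x, FunctionSpaces.Torus.gradient (ψ t) x⟫_ℝ +
          κ * ∑ i, a i * FunctionSpaces.Torus.partialDeriv i (FunctionSpaces.Torus.partialDeriv i (ψ t)) x) : ℝ) : ℂ)) =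
      ∑' k, ∫ t in Ioo 0 T, modeIntegrand κ a u θ ψ t k := by
    rw [← integral_complex_ofReal, integral_tsum_of_summable_integral_norm hint hsum]
    refine integral_congr_ae ?_
    filter_upwards [ae_hasSum_modeIntegrand (κ := κ) (a := a) hu hθ hψ] with t ht
    exact ht.tsum_eq.symm
  -- (2) per mode: `∫ f_k = -θ̂₀(k) conj(ψ̂(0)(k))`
  have h2 : ∀ k, ∫ t in Ioo 0 T, modeIntegrand κ a u θ ψ t k =
      -(mFourierCoeff (fun x => (θ₀ x : ℂ)) k * conj (testCoeff ψ 0 k)) := by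
    intro k
    have hφd : ∀ t, HasDerivAt (fun s => conj (testCoeff ψ s k))
        (conj (testCoeff (FunctionSpaces.Torus.timeDeriv ψ) t k)) t := fun t =>
      hasDerivAt_conj_comp (hasDerivAt_testCoeff hψ t k)
    have hφ'c : Continuous fun t => conj (testCoeff (FunctionSpaces.Torus.timeDeriv ψ) t k) :=
      Complex.continuous_conj.comp (continuous_testCoeff hψ.timeDeriv k)
    have hφ0' : ∀ t, T' ≤ t → conj (testCoeff ψ t k) = 0 := fun t ht => by rw [hψ0 t ht k, map_zero]
    have hN : IntegrableOn (fun t => transportCoeff u θ t k) (Ioo 0 T) := integrable_transportCoeff hu hθ k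
    have hc : ∀ t ∈ Icc 0 T, mFourierCoeff (fun x => (θ t x : ℂ)) k =
        ((Real.exp (-(diagRate κ a k * t)) : ℝ) : ℂ) * mFourierCoeff (fun x => (θ₀ x : ℂ)) k -
          ∫ s in Ioc 0 t, ((Real.exp (-(diagRate κ a k * (t - s))) : ℝ) : ℂ) * transportCoeff u θ s k := by
      intro t ht
      rw [hmild t ht k, mildMap_apply, duhamelCoeff_apply]
      simp only [add_zero]
    have key := mild_mode_weak_identity hT hN hc hφd hφ'c hT'T hφ0'
    have e : (fun t => modeIntegrand κ a u θ ψ t k) = fun t =>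
        mFourierCoeff (fun x => (θ t x : ℂ)) k * conj (testCoeff (FunctionSpaces.Torus.timeDeriv ψ) t k) -
          diagRate κ a k * mFourierCoeff (fun x => (θ t x : ℂ)) k * conj (testCoeff ψ t k) -
          transportCoeff u θ t k * conj (testCoeff ψ t k) := by
      funext t; rw [modeIntegrand]; ring
    rw [e]
    linear_combination key
  -- (3) the datum term
  have H3 := hasSum_conj_mul_mFourierCoeff_ofReal hθ₀ ((hψ.isSmooth_slice 0).memLp 2)
  -- (4) combine
  have hneg : HasSum (fun k => ∫ t in Ioo 0 T, modeIntegrand κ a u θ ψ t k) (-(((∫ x, θ₀ x * ψ 0 x : ℝ) : ℂ))) := by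
    have h := H3.neg
    refine h.congr_fun fun k => ?_
    rw [h2 k]
    show -(mFourierCoeff (fun x => (θ₀ x : ℂ)) k * conj (testCoeff ψ 0 k)) =
      -(conj (mFourierCoeff (fun x => ((ψ 0 x : ℝ) : ℂ)) k) * mFourierCoeff (fun x => ((θ₀ x : ℝ) : ℂ)) k)
    rw [testCoeff_apply, mul_comm]
  have htot : (((∫ t in Ioo 0 T, ∫ x, θ t x *
        (FunctionSpaces.Torus.timeDeriv ψ t x + ⟪u t x, FunctionSpaces.Torus.gradient (ψ t) x⟫_ℝ +
          κ * ∑ i, a i * FunctionSpaces.Torus.partialDeriv i (FunctionSpaces.Torus.partialDeriv i (ψ t)) x) : ℝ) : ℂ)) +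
      (((∫ x, θ₀ x * ψ 0 x : ℝ) : ℂ)) = 0 := by
    rw [h1, hneg.tsum_eq]
    ring
  exact_mod_cast htot

end WeakForm

end Torus

end Literature.Analysis.FluidPDE

end
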